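import Summits.ValiantsHypothesis.ValiantsHypothesis.Theorems.MonotoneRestorationOrbitCompressionQPPeeling
import Summits.ValiantsHypothesis.ValiantsHypothesis.Theorems.MonotoneRestorationOrbitCompressionQPStabiliserAverage
import Summits.ValiantsHypothesis.ValiantsHypothesis.Theorems.MonotoneRestorationOrbitCompressionQPDiNarrowToOrbit
import HarnessLib

/-!
# Route MonotoneRestoration — aside `OrbitCompressionQP` (stmt-ValiantsHypothesis-18332): the TERM LEMMA of
# the extraction S1b′ (Reynolds + peeling for one represented value)

Item evidence `S1b-plan.md`, step (ii)+(iii) combined.  A polynomial `w` is REPRESENTED on a label set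
`L ⊆ Fin k` by a one-sorted expression `e` at an assignment `ℓ` if `w = value e ℓ`, `ℓ` is injective on `L`,
and the value of `e` at assignments injective on `L` depends only on their restriction to `L`.  The term
lemma: for such `w` with `|L| ≤ 2s`, `3s ≤ k`, and a set `X` of `≤ s` indices carried injectively by labels
`LX` at `ℓ₀`, the STABILISER SUM `Σ_{ρ ∈ G_X} ρ • w` is a positive multiple of `value E ℓ₀` for an
expression `E` represented on `LX` — relabel `e` so that its `X`-valued labels sit on `LX` and the others on
fresh labels `t` (`exists_relabel`), average (`sum_stabiliser_comp_eq_smul_sum_injective`), and peel the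
labels `t` (`exists_injSum_expr`).

* `exists_relabel` — moving a representation along an injective relabelling;
* `exists_term` — the term lemma.

Helper file (`--supports stmt-ValiantsHypothesis-18332`); def-free; nothing here is a named fact.
-/

noncomputable section

open scoped Classical

-- `Summit.ValiantsHypothesis.ValiantsHypothesis.…` is the tree's single-conjunct layout (Sub = Summit).
set_option linter.dupNamespace false

namespace Summit.ValiantsHypothesis.ValiantsHypothesis.Theorems

namespace OrbitSupport

open Literature.Computability.AlgebraicComplexity MvPolynomial DiPatternExpr

variable {n k : ℕ}

/-- **Relabelling a representation.**  If the value of `e` at assignments injective on `L` depends only on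
their restriction to `L`, and `τ` is injective on `L`, then some expression `e'` takes, at every assignment
`ℓ'` injective on `τ(L)`, the value of `e` at `ℓ' ∘ τ` on `L`; and `e'` depends only on `τ(L)` in the same
sense. [folklore] -/
theorem exists_relabel (e : DiPatternExpr ℂ k) (L : Finset (Fin k))
    (hdep : ∀ ℓ₁ ℓ₂ : Fin k → Fin n, (∀ a ∈ L, ∀ b ∈ L, ℓ₁ a = ℓ₁ b → a = b) →
      (∀ a ∈ L, ∀ b ∈ L, ℓ₂ a = ℓ₂ b → a = b) → (∀ a ∈ L, ℓ₁ a = ℓ₂ a) →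
      value n e ℓ₁ = value n e ℓ₂)
    (τ : Fin k → Fin k) (hτ : ∀ a ∈ L, ∀ b ∈ L, τ a = τ b → a = b) :
    ∃ e' : DiPatternExpr ℂ k,
      (∀ (ℓ ℓ' : Fin k → Fin n), (∀ a ∈ L, ∀ b ∈ L, ℓ a = ℓ b → a = b) →
        (∀ a ∈ L, ℓ' (τ a) = ℓ a) → value n e' ℓ' = value n e ℓ) ∧
      (∀ ℓ₁ ℓ₂ : Fin k → Fin n, (∀ a ∈ L.image τ, ∀ b ∈ L.image τ, ℓ₁ a = ℓ₁ b → a = b) →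
        (∀ a ∈ L.image τ, ∀ b ∈ L.image τ, ℓ₂ a = ℓ₂ b → a = b) → (∀ a ∈ L.image τ, ℓ₁ a = ℓ₂ a) →
        value n e' ℓ₁ = value n e' ℓ₂) := by
  obtain ⟨σ, hσ⟩ := Equiv.Perm.exists_extending_pair (fun a : L => (a : Fin k)) (fun a : L => τ a)
    Subtype.val_injective (fun a b h => Subtype.ext (hτ a a.2 b b.2 h))
  have hσ' : ∀ a ∈ L, σ a = τ a := fun a ha => hσ ⟨a, ha⟩
  refine ⟨renameLabels σ e, fun ℓ ℓ' hℓ hℓ' => ?_, fun ℓ₁ ℓ₂ h₁ h₂ h₁₂ => ?_⟩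
  · rw [value_renameLabels]
    have hagree : ∀ a ∈ L, (ℓ' ∘ σ) a = ℓ a := fun a ha => by
      rw [Function.comp_apply, hσ' a ha, hℓ' a ha]
    refine hdep _ _ (fun a ha b hb h => hℓ a ha b hb ?_) hℓ hagree
    rwa [hagree a ha, hagree b hb] at h
  · rw [value_renameLabels, value_renameLabels]
    have hi : ∀ ℓ₀ : Fin k → Fin n, (∀ a ∈ L.image τ, ∀ b ∈ L.image τ, ℓ₀ a = ℓ₀ b → a = b) →
        ∀ a ∈ L, ∀ b ∈ L, (ℓ₀ ∘ σ) a = (ℓ₀ ∘ σ) b → a = b := by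
      intro ℓ₀ h a ha b hb hab
      simp only [Function.comp_apply, hσ' a ha, hσ' b hb] at hab
      exact hτ a ha b hb (h _ (Finset.mem_image_of_mem τ ha) _ (Finset.mem_image_of_mem τ hb) hab)
    exact hdep _ _ (hi ℓ₁ h₁) (hi ℓ₂ h₂) fun a ha => by
      simp only [Function.comp_apply, hσ' a ha]
      exact h₁₂ _ (Finset.mem_image_of_mem τ ha)

/-- **THE TERM LEMMA.**  Let `X` (`|X| ≤ s`) be carried injectively by the labels `LX` at `ℓ₀`
(`ℓ₀(LX) = X`), `3s ≤ k`, and let `w = value e ℓ` be represented on `L` (`|L| ≤ 2s`, `ℓ` injective on `L`,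
value depending only on `L` at assignments injective on `L`).  Then the stabiliser sum
`Σ_{ρ fixing X pointwise} ρ • w` equals `N • value E ℓ₀` for some `N ≥ 1` and an expression `E` represented
on `LX`. [cite: DawarPagoSeppelt2025, §4] -/
theorem exists_term {s : ℕ} (hk : 3 * s ≤ k) (X : Finset (Fin n)) (LX : Finset (Fin k))
    (ℓ₀ : Fin k → Fin n) (hLX : LX.image ℓ₀ = X) (hinjLX : ∀ a ∈ LX, ∀ b ∈ LX, ℓ₀ a = ℓ₀ b → a = b)
    (hXs : X.card ≤ s) (e : DiPatternExpr ℂ k) (ℓ : Fin k → Fin n) (L : Finset (Fin k))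
    (hL : L.card ≤ 2 * s) (hinjL : ∀ a ∈ L, ∀ b ∈ L, ℓ a = ℓ b → a = b)
    (hdep : ∀ ℓ₁ ℓ₂ : Fin k → Fin n, (∀ a ∈ L, ∀ b ∈ L, ℓ₁ a = ℓ₁ b → a = b) →
      (∀ a ∈ L, ∀ b ∈ L, ℓ₂ a = ℓ₂ b → a = b) → (∀ a ∈ L, ℓ₁ a = ℓ₂ a) →
      value n e ℓ₁ = value n e ℓ₂) :
    ∃ (E : DiPatternExpr ℂ k) (N : ℕ), 0 < N ∧
      (∀ ℓ₁ ℓ₂ : Fin k → Fin n, (∀ a ∈ LX, ∀ b ∈ LX, ℓ₁ a = ℓ₁ b → a = b) →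
        (∀ a ∈ LX, ∀ b ∈ LX, ℓ₂ a = ℓ₂ b → a = b) → (∀ a ∈ LX, ℓ₁ a = ℓ₂ a) →
        value n E ℓ₁ = value n E ℓ₂) ∧
      ∑ ρ ∈ Finset.univ.filter (fun ρ : Equiv.Perm (Fin n) => ∀ x ∈ X, ρ x = x),
          ren ρ (value n e ℓ) = N • value n E ℓ₀ := by
  -- (a) the values outside `X`, and fresh labels `t` for them
  set Y : Finset (Fin n) := (L.image ℓ) \ X with hY
  have hYX : ∀ y ∈ Y, y ∉ X := fun y hy => (Finset.mem_sdiff.1 hy).2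
  have hLXcard : LX.card = X.card := by rw [← hLX]; exact (Finset.card_image_of_injOn fun a ha b hb h =>
    hinjLX a ha b hb h).symm
  have hYcard : Y.card ≤ (Finset.univ \ LX).card := by
    rw [Finset.card_univ_sdiff, Fintype.card_fin]
    calc Y.card ≤ (L.image ℓ).card := Finset.card_le_card Finset.sdiff_subset
      _ ≤ L.card := Finset.card_image_le
      _ ≤ k - LX.card := by omega
  obtain ⟨t, htsub, htc⟩ := Finset.le_card_iff_exists_subset_card.1 hYcard
  have htLX : ∀ b ∈ t, b ∉ LX := fun b hb => (Finset.mem_sdiff.1 (htsub hb)).2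
  let φ : Y ≃ t := Fintype.equivOfCardEq (by simp [htc])
  -- (d) the relabelling
  have hXlab : ∀ x ∈ X, ∃ a ∈ LX, ℓ₀ a = x := fun x hx => Finset.mem_image.1 (hLX ▸ hx)
  let τ : Fin k → Fin k := fun a =>
    if hx : ℓ a ∈ X then Classical.choose (hXlab _ hx)
    else if hy : ℓ a ∈ Y then (φ ⟨ℓ a, hy⟩ : Fin k) else a
  have hτX : ∀ a, ℓ a ∈ X → τ a ∈ LX ∧ ℓ₀ (τ a) = ℓ a := fun a hx => by
    simp only [τ, dif_pos hx]; exact (Classical.choose_spec (hXlab _ hx))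
  have hLY : ∀ a ∈ L, ℓ a ∉ X → ℓ a ∈ Y := fun a ha hx =>
    Finset.mem_sdiff.2 ⟨Finset.mem_image_of_mem ℓ ha, hx⟩
  have hτY : ∀ a (ha : a ∈ L) (hx : ℓ a ∉ X), τ a = (φ ⟨ℓ a, hLY a ha hx⟩ : Fin k) := fun a ha hx => by
    simp only [τ, dif_neg hx, dif_pos (hLY a ha hx)]
  have hτYt : ∀ a ∈ L, ℓ a ∉ X → τ a ∈ t := fun a ha hx => by
    rw [hτY a ha hx]; exact (φ _).2
  have hτinj : ∀ a ∈ L, ∀ b ∈ L, τ a = τ b → a = b := by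
    intro a ha b hb hab
    by_cases hxa : ℓ a ∈ X
    · by_cases hxb : ℓ b ∈ X
      · have h1 := (hτX a hxa).2; have h2 := (hτX b hxb).2
        rw [hab] at h1
        exact hinjL a ha b hb (h1.symm.trans h2)
      · exact absurd ((hτX a hxa).1) (hab ▸ htLX _ (hτYt b hb hxb))
    · by_cases hxb : ℓ b ∈ X
      · exact absurd ((hτX b hxb).1) (hab ▸ htLX _ (hτYt a ha hxa))
      · have h := hab
        rw [hτY a ha hxa, hτY b hb hxb] at h
        have h' := φ.injective (Subtype.ext h)
        exact hinjL a ha b hb (congrArg Subtype.val h' : _)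
  -- (e) relabel `e` along `τ`
  obtain ⟨e', he'val, he'dep⟩ := exists_relabel e L hdep τ hτinj
  -- (f) the assignment carrying `X` on `LX` and `Y` on `t`
  let ℓ' : Fin k → Fin n := fun b => if hb : b ∈ t then ((φ.symm ⟨b, hb⟩ : Y) : Fin n) else ℓ₀ b
  have hℓ't : ∀ b (hb : b ∈ t), ℓ' b = ((φ.symm ⟨b, hb⟩ : Y) : Fin n) := fun b hb => by
    simp only [ℓ', dif_pos hb]
  have hℓ'nt : ∀ b, b ∉ t → ℓ' b = ℓ₀ b := fun b hb => by simp only [ℓ', dif_neg hb]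
  have hℓ'tY : ∀ b ∈ t, ℓ' b ∈ Y := fun b hb => by rw [hℓ't b hb]; exact (φ.symm _).2
  have hℓ'τ : ∀ a ∈ L, ℓ' (τ a) = ℓ a := by
    intro a ha
    by_cases hx : ℓ a ∈ X
    · rw [hℓ'nt _ (fun ht => htLX _ ht (hτX a hx).1)]
      exact (hτX a hx).2
    · have hmem := hτYt a ha hx
      rw [hℓ't _ hmem]
      have : (⟨τ a, hmem⟩ : t) = φ ⟨ℓ a, hLY a ha hx⟩ := Subtype.ext (hτY a ha hx)
      rw [this, Equiv.symm_apply_apply]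
  have hval : value n e' ℓ' = value n e ℓ := he'val ℓ ℓ' hinjL hℓ'τ
  -- (g) injectivity of `ℓ'` on `LX ∪ t`, and of `ℓ₀` there off `t`
  have hℓ'LX : ∀ a ∈ LX, ℓ' a = ℓ₀ a := fun a ha => hℓ'nt a fun ht => htLX a ht ha
  have hℓ₀X : ∀ a ∈ LX, ℓ₀ a ∈ X := fun a ha => hLX ▸ Finset.mem_image_of_mem ℓ₀ ha
  have hinj' : ∀ a ∈ LX ∪ t, ∀ b ∈ LX ∪ t, ℓ' a = ℓ' b → a = b := by
    intro a ha b hb hab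
    rcases Finset.mem_union.1 ha with ha | ha <;> rcases Finset.mem_union.1 hb with hb | hb
    · rw [hℓ'LX a ha, hℓ'LX b hb] at hab; exact hinjLX a ha b hb hab
    · exact absurd (hℓ'LX a ha ▸ hℓ₀X a ha) (hab ▸ hYX _ (hℓ'tY b hb))
    · exact absurd (hℓ'LX b hb ▸ hℓ₀X b hb) (hab.symm ▸ hYX _ (hℓ'tY a ha))
    · rw [hℓ't a ha, hℓ't b hb] at hab
      have := φ.symm.injective (Subtype.ext hab)
      exact congrArg Subtype.val this
  have himτ : ∀ c ∈ L.image τ, c ∈ LX ∪ t := by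
    intro c hc
    obtain ⟨a, ha, rfl⟩ := Finset.mem_image.1 hc
    by_cases hx : ℓ a ∈ X
    · exact Finset.mem_union_left _ (hτX a hx).1
    · exact Finset.mem_union_right _ (hτYt a ha hx)
  -- dependence of `e'` in the form we use: injective on `LX ∪ t`, agreeing on `LX ∪ t`
  have hdep' : ∀ ℓ₁ ℓ₂ : Fin k → Fin n, (∀ a ∈ LX ∪ t, ∀ b ∈ LX ∪ t, ℓ₁ a = ℓ₁ b → a = b) →
      (∀ a ∈ LX ∪ t, ∀ b ∈ LX ∪ t, ℓ₂ a = ℓ₂ b → a = b) → (∀ a ∈ LX ∪ t, ℓ₁ a = ℓ₂ a) →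
      value n e' ℓ₁ = value n e' ℓ₂ := fun ℓ₁ ℓ₂ h₁ h₂ h₁₂ =>
    he'dep ℓ₁ ℓ₂ (fun a ha b hb => h₁ a (himτ a ha) b (himτ b hb))
      (fun a ha b hb => h₂ a (himτ a ha) b (himτ b hb)) (fun a ha => h₁₂ a (himτ a ha))
  -- (i) averaging over the stabiliser
  obtain ⟨N, hN, hsum⟩ := sum_stabiliser_comp_eq_smul_sum_injective (ι := t) X
    (fun b : t => ℓ' b) (fun b₁ b₂ h => Subtype.ext (hinj' _ (Finset.mem_union_right _ b₁.2) _
      (Finset.mem_union_right _ b₂.2) h)) (fun b => hYX _ (hℓ'tY b b.2))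
  let ext : (t → Fin n) → Fin k → Fin n := fun g b => if hb : b ∈ t then g ⟨b, hb⟩ else ℓ₀ b
  have hext_t : ∀ g b (hb : b ∈ t), ext g b = g ⟨b, hb⟩ := fun g b hb => by simp only [ext, dif_pos hb]
  have hext_nt : ∀ g b, b ∉ t → ext g b = ℓ₀ b := fun g b hb => by simp only [ext, dif_neg hb]
  have hρU : ∀ ρ : Equiv.Perm (Fin n), (∀ x ∈ X, ρ x = x) → ∀ y, y ∉ X → ρ y ∉ X := by
    intro ρ hρ y hy hρy
    have : ρ (ρ y) = ρ y := hρ _ hρy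
    exact hy (ρ.injective this ▸ hρy)
  -- injectivity of `ext g` on `LX ∪ t` for admissible `g`
  have hext_inj : ∀ g : t → Fin n, Function.Injective g → (∀ b, g b ∉ X) →
      ∀ a ∈ LX ∪ t, ∀ b ∈ LX ∪ t, ext g a = ext g b → a = b := by
    intro g hg hgX a ha b hb hab
    have haLX : a ∈ LX → a ∉ t := fun h ht => htLX a ht h
    have hbLX : b ∈ LX → b ∉ t := fun h ht => htLX b ht h
    rcases Finset.mem_union.1 ha with ha | ha <;> rcases Finset.mem_union.1 hb with hb | hb
    · rw [hext_nt g a (haLX ha), hext_nt g b (hbLX hb)] at hab; exact hinjLX a ha b hb hab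
    · rw [hext_nt g a (haLX ha), hext_t g b hb] at hab; exact absurd (hab ▸ hℓ₀X a ha) (hgX _)
    · rw [hext_t g a ha, hext_nt g b (hbLX hb)] at hab; exact absurd (hab.symm ▸ hℓ₀X b hb) (hgX _)
    · rw [hext_t g a ha, hext_t g b hb] at hab; exact congrArg Subtype.val (hg hab)
  have hstep1 : ∑ ρ ∈ Finset.univ.filter (fun ρ : Equiv.Perm (Fin n) => ∀ x ∈ X, ρ x = x),
      ren ρ (value n e ℓ) =
      ∑ ρ ∈ Finset.univ.filter (fun ρ : Equiv.Perm (Fin n) => ∀ x ∈ X, ρ x = x),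
        value n e' (ext (⇑ρ ∘ fun b : t => ℓ' b)) := by
    refine Finset.sum_congr rfl fun ρ hρ => ?_
    have hρ' : ∀ x ∈ X, ρ x = x := (Finset.mem_filter.1 hρ).2
    rw [← hval, NarrowToOrbit.ren_diValue]
    refine hdep' _ _ (fun a ha b hb h => hinj' a ha b hb (ρ.injective h))
      (hext_inj _ ((ρ.injective.comp fun b₁ b₂ h => Subtype.ext (hinj' _ (Finset.mem_union_right _ b₁.2)
        _ (Finset.mem_union_right _ b₂.2) h))) fun b => hρU ρ hρ' _ (hYX _ (hℓ'tY b b.2)))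
      fun a ha => ?_
    rcases Finset.mem_union.1 ha with ha | ha
    · rw [Function.comp_apply, hext_nt _ a (fun ht => htLX a ht ha), hℓ'LX a ha, hρ' _ (hℓ₀X a ha)]
    · rw [Function.comp_apply, hext_t _ a ha]; rfl
  have hsum' := hsum (fun g => value n e' (ext g))
  beta_reduce at hsum'
  rw [hstep1, hsum']
  -- (j) peel the labels `t`
  obtain ⟨E, hE⟩ := exists_injSum_expr (k := k) LX t.toList (Finset.nodup_toList t)
    (fun a ha => htLX a (Finset.mem_toList.1 ha)) e'
  have hLt : ∀ x, x ∈ t.toList.toFinset ∪ LX ↔ x ∈ LX ∪ t := fun x => by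
    simp only [Finset.mem_union, Finset.toList_toFinset]; tauto
  -- re-index the injective assignments as the peeling set at `ℓ₀`
  have hreidx : ∀ ℓ₁ : Fin k → Fin n, (∀ a, a ∉ t → ℓ₁ a = ℓ₀ a) →
      ∑ g ∈ Finset.univ.filter (fun g : t → Fin n => Function.Injective g ∧ ∀ a, g a ∉ X),
        value n e' (ext g) =
      ∑ ℓ'' ∈ Finset.univ.filter (fun ℓ'' : Fin k → Fin n =>
          (∀ x, x ∉ t.toList → ℓ'' x = ℓ₁ x) ∧
          ∀ x ∈ t.toList.toFinset ∪ LX, ∀ y ∈ t.toList.toFinset ∪ LX, ℓ'' x = ℓ'' y → x = y),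
        value n e' ℓ'' := by
    intro ℓ₁ hℓ₁
    refine Finset.sum_bij' (fun g _ => ext g) (fun ℓ'' _ => fun b : t => ℓ'' b) ?_ ?_ ?_ ?_ ?_
    · intro g hg
      obtain ⟨-, hg1, hg2⟩ := Finset.mem_filter.1 hg
      refine Finset.mem_filter.2 ⟨Finset.mem_univ _, fun x hx => ?_, fun x hx y hy h => ?_⟩
      · rw [hext_nt g x (fun h => hx (Finset.mem_toList.2 h)), hℓ₁ x (fun h => hx (Finset.mem_toList.2 h))]
      · exact hext_inj g hg1 hg2 x ((hLt x).1 hx) y ((hLt y).1 hy) h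
    · intro ℓ'' hℓ''
      obtain ⟨-, h1, h2⟩ := Finset.mem_filter.1 hℓ''
      refine Finset.mem_filter.2 ⟨Finset.mem_univ _, fun b₁ b₂ h => Subtype.ext (h2 _ ((hLt _).2
        (Finset.mem_union_right _ b₁.2)) _ ((hLt _).2 (Finset.mem_union_right _ b₂.2)) h), fun b hbX => ?_⟩
      obtain ⟨a, ha, hab⟩ := hXlab _ hbX
      have hat : a ∉ t := fun ht => htLX a ht ha
      have h3 : ℓ'' a = ℓ'' b := by
        rw [h1 a (fun h => hat (Finset.mem_toList.1 h)), hℓ₁ a hat]; exact hab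
      have h4 := h2 a ((hLt a).2 (Finset.mem_union_left _ ha)) b ((hLt _).2
        (Finset.mem_union_right _ b.2)) h3
      exact hat (by rw [h4]; exact b.2)
    · intro g _
      funext b
      simp only [hext_t g b b.2]
    · intro ℓ'' hℓ''
      obtain ⟨-, h1, -⟩ := Finset.mem_filter.1 hℓ''
      funext b
      by_cases hb : b ∈ t
      · rw [hext_t (fun b : t => ℓ'' b) b hb]
      · rw [hext_nt (fun b : t => ℓ'' b) b hb, h1 b (fun h => hb (Finset.mem_toList.1 h)), hℓ₁ b hb]
    · intro g _; rfl
  refine ⟨E, N, hN, ?_, ?_⟩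
  · -- (k) `E` depends only on `LX`
    intro ℓ₁ ℓ₂ h₁ h₂ h₁₂
    rw [hE n ℓ₁ h₁, hE n ℓ₂ h₂]
    refine Finset.sum_bij' (fun ℓ'' _ => fun b => if b ∈ t then ℓ'' b else ℓ₂ b)
      (fun ℓ'' _ => fun b => if b ∈ t then ℓ'' b else ℓ₁ b) ?_ ?_ ?_ ?_ ?_
    · intro ℓ'' hℓ''
      obtain ⟨-, ha1, ha2⟩ := Finset.mem_filter.1 hℓ''
      refine Finset.mem_filter.2 ⟨Finset.mem_univ _, fun x hx => ?_, fun x hx y hy h => ?_⟩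
      · show (if x ∈ t then ℓ'' x else ℓ₂ x) = ℓ₂ x
        rw [if_neg (fun h => hx (Finset.mem_toList.2 h))]
      · apply ha2 x hx y hy
        beta_reduce at h
        have ex : ∀ z ∈ t.toList.toFinset ∪ LX, (if z ∈ t then ℓ'' z else ℓ₂ z) = ℓ'' z := by
          intro z hz
          by_cases hzt : z ∈ t
          · simp [hzt]
          · have hzLX : z ∈ LX := by
              rcases Finset.mem_union.1 ((hLt z).1 hz) with h | h
              · exact h
              · exact absurd h hzt
            simp only [hzt, if_false]
            rw [← h₁₂ z hzLX, ← ha1 z (fun h => hzt (Finset.mem_toList.1 h))]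
        rwa [ex x hx, ex y hy] at h
    · intro ℓ'' hℓ''
      obtain ⟨-, ha1, ha2⟩ := Finset.mem_filter.1 hℓ''
      refine Finset.mem_filter.2 ⟨Finset.mem_univ _, fun x hx => ?_, fun x hx y hy h => ?_⟩
      · show (if x ∈ t then ℓ'' x else ℓ₁ x) = ℓ₁ x
        rw [if_neg (fun h => hx (Finset.mem_toList.2 h))]
      · apply ha2 x hx y hy
        beta_reduce at h
        have ex : ∀ z ∈ t.toList.toFinset ∪ LX, (if z ∈ t then ℓ'' z else ℓ₁ z) = ℓ'' z := by
          intro z hz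
          by_cases hzt : z ∈ t
          · simp [hzt]
          · have hzLX : z ∈ LX := by
              rcases Finset.mem_union.1 ((hLt z).1 hz) with h | h
              · exact h
              · exact absurd h hzt
            simp only [hzt, if_false]
            rw [h₁₂ z hzLX, ← ha1 z (fun h => hzt (Finset.mem_toList.1 h))]
        rwa [ex x hx, ex y hy] at h
    · intro ℓ'' hℓ''
      obtain ⟨-, ha1, -⟩ := Finset.mem_filter.1 hℓ''
      funext b
      by_cases hb : b ∈ t
      · simp [hb]
      · simp [hb, ha1 b (fun h => hb (Finset.mem_toList.1 h))]
    · intro ℓ'' hℓ''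
      obtain ⟨-, ha1, -⟩ := Finset.mem_filter.1 hℓ''
      funext b
      by_cases hb : b ∈ t
      · simp [hb]
      · simp [hb, ha1 b (fun h => hb (Finset.mem_toList.1 h))]
    · intro ℓ'' hℓ''
      obtain ⟨-, ha1, ha2⟩ := Finset.mem_filter.1 hℓ''
      refine hdep' _ _ (fun a ha b hb h => ha2 a ((hLt a).2 ha) b ((hLt b).2 hb) h) ?_ ?_
      · intro a ha b hb h
        apply ha2 a ((hLt a).2 ha) b ((hLt b).2 hb)
        beta_reduce at h
        have ex : ∀ z ∈ LX ∪ t, (if z ∈ t then ℓ'' z else ℓ₂ z) = ℓ'' z := by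
          intro z hz
          by_cases hzt : z ∈ t
          · simp [hzt]
          · have hzLX : z ∈ LX := by
              rcases Finset.mem_union.1 hz with h | h
              · exact h
              · exact absurd h hzt
            simp only [hzt, if_false]
            rw [← h₁₂ z hzLX, ← ha1 z (fun h => hzt (Finset.mem_toList.1 h))]
        rwa [ex a ha, ex b hb] at h
      · intro a ha
        show ℓ'' a = (if a ∈ t then ℓ'' a else ℓ₂ a)
        by_cases hat : a ∈ t
        · simp [hat]
        · have haLX : a ∈ LX := by
            rcases Finset.mem_union.1 ha with h | h
            · exact h
            · exact absurd h hat
          simp only [hat, if_false]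
          rw [ha1 a (fun h => hat (Finset.mem_toList.1 h)), h₁₂ a haLX]
  · -- the identity at `ℓ₀`
    have h1 := hreidx ℓ₀ (fun a _ => rfl)
    have h2 := hE n ℓ₀ hinjLX
    rw [h2]
    congr 1
    convert h1 using 2
    ext g
    simp only [Finset.mem_filter, Finset.mem_univ, true_and]

end OrbitSupport

end Summit.ValiantsHypothesis.ValiantsHypothesis.Theorems

end
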